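import Summits.PneNP.PneNP.Theses.Feige
import Literature.Computability.Complexity.ClayProblemProofs
import Literature.Computability.Complexity.NegCNFTranscoder

/-!
# PneNP / Feige — `SatMemNPCook` (stmt-PneNP-1086): `SAT ∈ NP` for the summit Statement's class

Route `PneNP/Feige`, item stmt-PneNP-1086 (`Summit.PneNP.PneNP.Theses.Feige.SatMemNPCook`):
`SAT ∈ PNPWave0.NP Bool` (Cook's checking-relation form over `Option Bool`). By the proved model
bridge `NP_bool_eq_holds : PNPWave0.NP Bool = Nondeterministic.NP` (ClayProblemProofs) and the
proved `SAT_mem_NP_holds : SAT ∈ Nondeterministic.NP` (Cook–Levin side, NegCNFTranscoder).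

* `feige_satMemNPCook_proof` — the item.

References: S. Cook, STOC 1971, Thm 1; S. Arora, B. Barak, *Computational Complexity* (2009),
Def. 2.1 and §2.3.
-/

namespace Summit.PneNP.PneNP.Theorems

/-- **`SAT ∈ NP` in the Statement's class** (item stmt-PneNP-1086 of route `PneNP/Feige`):
rewrite the Wave-0 class to Mathlib-TM2 `NP` by `NP_bool_eq_holds` and use `SAT_mem_NP_holds`.
[Cook 1971, Thm 1; Arora–Barak 2009, Def. 2.1, §2.3] -/
theorem feige_satMemNPCook_proof : Summit.PneNP.PneNP.Theses.Feige.SatMemNPCook := by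
  unfold Summit.PneNP.PneNP.Theses.Feige.SatMemNPCook
  rw [Literature.Computability.Complexity.NP_bool_eq_holds]
  exact Literature.Computability.Complexity.SAT_mem_NP_holds

end Summit.PneNP.PneNP.Theorems
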